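import Summits.Schanuel.Schanuel.Theorems.RootDecomp1BTameFlagDefs
import Summits.Schanuel.Schanuel.Theorems.RootDecomp1EAnchorToolkit

/-!
# RootDecomp1BTameFlagCore — tame/wild toolkit of lens 4 gen 8 (node `PolarWildFlag`), Theses-independent port, part 1

Generic transcendence-degree / algebraicity lemmas (twins of landed ones are imported from
`RootDecomp1EAnchorToolkit`), the tame/wild dichotomy (`isTame_or_isWild`,
`isWild_iff_not_isTame`), pair-degree bounds, fed ⟹ tame (`lastTame_of_lastFed`, `isTame_of_isFed`) and
coordinate-span monotonicity, over the statements of `RootDecomp1BTameFlagDefs.lean` and the landed gen-7 kernel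
`RootDecomp1BFedFlagCore.lean`.  Part 2 (the flag kernel `tameKleinPolar_of_flag_steps`, `wild_dichotomy`, the
fed corollaries) is `RootDecomp1BTameFlagSteps.lean`.  Extracted mechanically (dependency closure) from
HOME/decomp-schanuel-lens-4/g8/PolarWildFlag.lean; sorry-free; standard axioms.
-/

open Complex IntermediateField
open Literature.NumberTheory.Transcendental (trdeg_adjoin_le_of_le isAlgebraic_adjoin_over_algebraAdjoin)
open Summit.Schanuel.Schanuel.Theorems.RootDecomp1EAnchor (trdeg_adjoin_union_le_sum trdeg_adjoin_le_of_isAlgebraic)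

namespace Summit.Schanuel.Schanuel.Theorems.RootDecomp1BTameFlagCore

set_option linter.dupNamespace false

open Summit.Schanuel.Schanuel.Theorems.RootDecomp1BFedFlagCore (FedSharpStep FedSurplusOneStep KleinIH polarDeg baseField IsFed polarGens polarField LastFed FedKleinPolar gens_mono range_polar_init_subset trdeg_adjoin_lt_aleph0 polarDeg_lt_aleph0 coord_mem_span linearIndependent_init two_mul_le_polarDeg_init polarDeg_init_le exists_int_clear coe_mem_adjoin_of_mem_span exists_rebase coe_mem_polarField exp_coe_mem_polarField exp_coe_mul_I_mem_polarField exp_intComb_mem_polarField baseField_le_polarField)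

section

variable {m : ℕ}

/-- A field generated by `S` has transcendence degree `≤ #S` (`F(S)` is algebraic over `F[S]`, so a
transcendence basis may be chosen inside `S`). [folklore; same proof as the tree's
`Literature.NumberTheory.Transcendental.trdeg_adjoin_le_cardinalMk`, inlined to keep the import cone small] -/
theorem trdeg_adjoin_le_cardinalMk {F E : Type*} [Field F] [Field E] [Algebra F E] (S : Set E) :
    Algebra.trdeg F ↥(IntermediateField.adjoin F S) ≤ Cardinal.mk S := by
  haveI := isAlgebraic_adjoin_over_algebraAdjoin (F := F) S
  exact (Algebra.IsAlgebraic.trdeg_le_cardinalMk F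
      (((↑) : ↥(IntermediateField.adjoin F S) → E) ⁻¹' S) (A := ↥(IntermediateField.adjoin F S))).trans
    (Cardinal.mk_preimage_of_injective _ _ Subtype.val_injective)

set_option synthInstance.maxHeartbeats 200000 in
set_option synthInstance.maxHeartbeats 200000 in
/-- `i` is algebraic over every subfield of `ℂ` (`i² = -1`). -/
theorem isAlgebraic_I (K : IntermediateField ℚ ℂ) : IsAlgebraic (↥K) Complex.I :=
  (IsAlgebraic.of_pow two_pos (by rw [Complex.I_sq]; exact isAlgebraic_one.neg) :
    IsAlgebraic ℚ Complex.I).tower_top (↥K)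

/-- The base degree `trdeg ℚ(polar generators of r)` is finite. -/
theorem baseDeg_lt_aleph0 {m : ℕ} (r : Fin m → ℝ) : baseDeg r < Cardinal.aleph0 :=
  trdeg_adjoin_lt_aleph0 (Set.finite_range _)

set_option synthInstance.maxHeartbeats 200000 in
/-- `trdeg ℚ(S ∪ T) ≤ trdeg ℚ(S) + #T` (tower law + generators bound). [folklore] -/
theorem trdeg_union_le_add_mk (S T : Set ℂ) :
    Algebra.trdeg ℚ ↥(adjoin ℚ (S ∪ T)) ≤ Algebra.trdeg ℚ ↥(adjoin ℚ S) + Cardinal.mk T :=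
  calc Algebra.trdeg ℚ ↥(adjoin ℚ (S ∪ T))
      ≤ Algebra.trdeg ℚ ↥(adjoin ℚ S) + Algebra.trdeg ↥(adjoin ℚ S) ↥(adjoin (↥(adjoin ℚ S)) T) :=
        trdeg_adjoin_union_le_sum (K := ℚ) _ _
    _ ≤ Algebra.trdeg ℚ ↥(adjoin ℚ S) + Cardinal.mk T := add_le_add le_rfl (trdeg_adjoin_le_cardinalMk _)

/-- Algebraicity over a subfield passes to every larger subfield. -/
theorem isAlgebraic_of_le {K L : IntermediateField ℚ ℂ} (hKL : K ≤ L) {x : ℂ} (h : IsAlgebraic (↥K) x) :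
    IsAlgebraic (↥L) x := by
  obtain ⟨p, hp0, hpx⟩ := h
  have hinj : Function.Injective (IntermediateField.inclusion hKL).toRingHom :=
    (IntermediateField.inclusion hKL).toRingHom.injective
  refine ⟨p.map (IntermediateField.inclusion hKL).toRingHom, ?_, ?_⟩
  · exact (Polynomial.map_ne_zero_iff hinj).mpr hp0
  · have hc : (algebraMap (↥L) ℂ).comp (IntermediateField.inclusion hKL).toRingHom = algebraMap (↥K) ℂ :=
      RingHom.ext fun y => rfl
    rw [Polynomial.aeval_def, Polynomial.eval₂_map, hc, ← Polynomial.aeval_def, hpx]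

/-- The pair `{e^{v}, e^{iv}}` is a finite set. -/
theorem pair_finite (v : ℝ) :
    ({Complex.exp ((v : ℝ) : ℂ), Complex.exp (((v : ℝ) : ℂ) * Complex.I)} : Set ℂ).Finite :=
  Set.toFinite _

/-- The pair degree is finite. -/
theorem pairDeg_lt_aleph0 (r : Fin m → ℝ) (v : ℝ) : pairDeg r v < Cardinal.aleph0 :=
  trdeg_adjoin_lt_aleph0 ((Set.finite_range _).union (pair_finite v))

/-- membership in a subfield gives algebraicity over it. -/
theorem isAlgebraic_of_mem' (K : IntermediateField ℚ ℂ) {x : ℂ} (hx : x ∈ K) : IsAlgebraic (↥K) x :=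
  isAlgebraic_algebraMap (⟨x, hx⟩ : ↥K)

/-- Wild is the negation of tame (the pair degree is at most base degree `+ 2`). -/
theorem isWild_iff_not_isTame (r : Fin m → ℝ) : IsWild m r ↔ ¬ IsTame m r := by
  constructor
  · rintro h ⟨v, hv, hv0, hle⟩
    have h2 := h v hv hv0
    obtain ⟨nρ, hnρ⟩ := Cardinal.lt_aleph0.mp (baseDeg_lt_aleph0 r)
    obtain ⟨np, hnp⟩ := Cardinal.lt_aleph0.mp (pairDeg_lt_aleph0 r v)
    rw [hnρ, hnp] at h2 hle
    norm_cast at h2 hle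
    omega
  · intro h v hv hv0
    by_contra hlt
    apply h
    refine ⟨v, hv, hv0, ?_⟩
    obtain ⟨nρ, hnρ⟩ := Cardinal.lt_aleph0.mp (baseDeg_lt_aleph0 r)
    obtain ⟨np, hnp⟩ := Cardinal.lt_aleph0.mp (pairDeg_lt_aleph0 r v)
    rw [hnρ, hnp] at hlt ⊢
    norm_cast at hlt ⊢
    omega

/-- Tame/wild dichotomy for a direction tuple. -/
theorem isTame_or_isWild (r : Fin m → ℝ) : IsTame m r ∨ IsWild m r := by
  rw [isWild_iff_not_isTame]; exact em _

set_option synthInstance.maxHeartbeats 200000 in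
/-- κ ≤ 1 from ONE relation: `e^{v}` algebraic over `ℚ(r)(e^{iv})` ⟹ `pairDeg r v ≤ ρ(r) + 1`. -/
theorem pairDeg_le_of_isAlgebraic_exp_rel (r : Fin m → ℝ) {v : ℝ}
    (h : IsAlgebraic ↥(IntermediateField.adjoin ℚ (Set.range (fun j => ((r j : ℝ) : ℂ)) ∪
      {Complex.exp (((v : ℝ) : ℂ) * Complex.I)})) (Complex.exp ((v : ℝ) : ℂ))) :
    pairDeg r v ≤ baseDeg r + 1 := by
  have hK : ∀ x ∈ Set.range (fun j => ((r j : ℝ) : ℂ)) ∪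
      {Complex.exp ((v : ℝ) : ℂ), Complex.exp (((v : ℝ) : ℂ) * Complex.I)},
      IsAlgebraic ↥(IntermediateField.adjoin ℚ (Set.range (fun j => ((r j : ℝ) : ℂ)) ∪
        {Complex.exp (((v : ℝ) : ℂ) * Complex.I)})) x := by
    rintro x (hx | hx)
    · exact isAlgebraic_of_mem' _ (subset_adjoin ℚ _ (Or.inl hx))
    · simp only [Set.mem_insert_iff, Set.mem_singleton_iff] at hx
      rcases hx with rfl | rfl
      · exact h
      · exact isAlgebraic_of_mem' _ (subset_adjoin ℚ _ (Or.inr rfl))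
  calc pairDeg r v ≤ Algebra.trdeg ℚ ↥(IntermediateField.adjoin ℚ (Set.range (fun j => ((r j : ℝ) : ℂ)) ∪
        {Complex.exp (((v : ℝ) : ℂ) * Complex.I)})) := trdeg_adjoin_le_of_isAlgebraic hK
    _ ≤ baseDeg r + Cardinal.mk ↥({Complex.exp (((v : ℝ) : ℂ) * Complex.I)} : Set ℂ) := trdeg_union_le_add_mk _ _
    _ = baseDeg r + 1 := by rw [Cardinal.mk_singleton]

set_option synthInstance.maxHeartbeats 200000 in
/-- … symmetrically: `e^{iv}` algebraic over `ℚ(r)(e^{v})` ⟹ `pairDeg r v ≤ ρ(r) + 1`. -/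
theorem pairDeg_le_of_isAlgebraic_exp_mul_I_rel (r : Fin m → ℝ) {v : ℝ}
    (h : IsAlgebraic ↥(IntermediateField.adjoin ℚ (Set.range (fun j => ((r j : ℝ) : ℂ)) ∪
      {Complex.exp ((v : ℝ) : ℂ)})) (Complex.exp (((v : ℝ) : ℂ) * Complex.I))) :
    pairDeg r v ≤ baseDeg r + 1 := by
  have hK : ∀ x ∈ Set.range (fun j => ((r j : ℝ) : ℂ)) ∪
      {Complex.exp ((v : ℝ) : ℂ), Complex.exp (((v : ℝ) : ℂ) * Complex.I)},
      IsAlgebraic ↥(IntermediateField.adjoin ℚ (Set.range (fun j => ((r j : ℝ) : ℂ)) ∪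
        {Complex.exp ((v : ℝ) : ℂ)})) x := by
    rintro x (hx | hx)
    · exact isAlgebraic_of_mem' _ (subset_adjoin ℚ _ (Or.inl hx))
    · simp only [Set.mem_insert_iff, Set.mem_singleton_iff] at hx
      rcases hx with rfl | rfl
      · exact isAlgebraic_of_mem' _ (subset_adjoin ℚ _ (Or.inr rfl))
      · exact h
  calc pairDeg r v ≤ Algebra.trdeg ℚ ↥(IntermediateField.adjoin ℚ (Set.range (fun j => ((r j : ℝ) : ℂ)) ∪
        {Complex.exp ((v : ℝ) : ℂ)})) := trdeg_adjoin_le_of_isAlgebraic hK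
    _ ≤ baseDeg r + Cardinal.mk ↥({Complex.exp ((v : ℝ) : ℂ)} : Set ℂ) := trdeg_union_le_add_mk _ _
    _ = baseDeg r + 1 := by rw [Cardinal.mk_singleton]

/-- If `e^{v}` is algebraic over the polar field, the pair degree is at most base degree `+ 1`. -/
theorem pairDeg_le_of_isAlgebraic_exp (r : Fin m → ℝ) {v : ℝ}
    (h : IsAlgebraic ↥(baseField r) (Complex.exp ((v : ℝ) : ℂ))) : pairDeg r v ≤ baseDeg r + 1 :=
  pairDeg_le_of_isAlgebraic_exp_rel r (isAlgebraic_of_le (adjoin.mono ℚ _ _ Set.subset_union_left) h)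

/-- If `e^{iv}` is algebraic over the polar field, the pair degree is at most base degree `+ 1`. -/
theorem pairDeg_le_of_isAlgebraic_exp_mul_I (r : Fin m → ℝ) {v : ℝ}
    (h : IsAlgebraic ↥(baseField r) (Complex.exp (((v : ℝ) : ℂ) * Complex.I))) : pairDeg r v ≤ baseDeg r + 1 :=
  pairDeg_le_of_isAlgebraic_exp_mul_I_rel r (isAlgebraic_of_le (adjoin.mono ℚ _ _ Set.subset_union_left) h)

/-- FED ⟹ TAME at the last coordinate (the ledger glue `TameSharpStep → FedSharpStep` is this, pointwise). -/
theorem lastTame_of_lastFed {r : Fin (m + 1) → ℝ} (h : LastFed m r) : LastTame m r := by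
  rcases h with h | h
  · exact pairDeg_le_of_isAlgebraic_exp r h
  · exact pairDeg_le_of_isAlgebraic_exp_mul_I r h

/-- FED ⟹ TAME. -/
theorem isTame_of_isFed {r : Fin m → ℝ} (h : IsFed m r) : IsTame m r := by
  obtain ⟨v, hv, hv0, halg⟩ := h
  refine ⟨v, hv, hv0, ?_⟩
  rcases halg with h | h
  · exact pairDeg_le_of_isAlgebraic_exp r h
  · exact pairDeg_le_of_isAlgebraic_exp_mul_I r h

/-- A tuple whose last direction is tame is tame. -/
theorem isTame_of_lastTame {r : Fin (m + 1) → ℝ} (hr : LinearIndependent ℚ r) (h : LastTame m r) :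
    IsTame (m + 1) r :=
  ⟨r (Fin.last m), coord_mem_span r _, hr.ne_zero _, h⟩

/-- Base fields are monotone under `ℚ`-span inclusion of the coordinates. -/
theorem baseField_le_of_coords_mem {k n : ℕ} {s : Fin k → ℝ} {r : Fin n → ℝ}
    (hs : ∀ j, s j ∈ Submodule.span ℚ (Set.range r)) : baseField s ≤ baseField r := by
  change IntermediateField.adjoin ℚ _ ≤ _
  rw [adjoin_le_iff]
  rintro _ ⟨j, rfl⟩
  exact coe_mem_adjoin_of_mem_span r (hs j)

/-- Base degrees are monotone under `ℚ`-span inclusion of the coordinates. -/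
theorem baseDeg_le_of_coords_mem {k n : ℕ} {s : Fin k → ℝ} {r : Fin n → ℝ}
    (hs : ∀ j, s j ∈ Submodule.span ℚ (Set.range r)) : baseDeg s ≤ baseDeg r :=
  trdeg_le_of_injective (IntermediateField.inclusion (baseField_le_of_coords_mem hs))
    (IntermediateField.inclusion_injective _)

/-- Base degree only depends on the `ℚ`-span of the coordinates. -/
theorem baseDeg_eq_of_span_eq {k n : ℕ} {w : Fin k → ℝ} {r : Fin n → ℝ}
    (hw : ∀ j, w j ∈ Submodule.span ℚ (Set.range r)) (hr : ∀ i, r i ∈ Submodule.span ℚ (Set.range w)) :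
    baseDeg w = baseDeg r :=
  le_antisymm (baseDeg_le_of_coords_mem hw) (baseDeg_le_of_coords_mem hr)

/-- Each initial coordinate lies in the `ℚ`-span of the full tuple. -/
theorem init_mem_span (r : Fin (m + 1) → ℝ) (j : Fin m) : Fin.init r j ∈ Submodule.span ℚ (Set.range r) :=
  Submodule.subset_span ⟨Fin.castSucc j, rfl⟩

/-- Clearing denominators: a rational tuple is an integer tuple divided by a positive natural. -/
theorem exists_int_clear' {k : ℕ} (c : Fin k → ℚ) :
    ∃ (N : ℕ) (n : Fin k → ℤ), 0 < N ∧ ∀ j, (N : ℚ) * c j = (n j : ℚ) := by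
  classical
  refine ⟨∏ j, (c j).den, fun j => (∏ i ∈ Finset.univ.erase j, ((c i).den : ℤ)) * (c j).num,
    Finset.prod_pos fun j _ => (c j).den_pos, fun j => ?_⟩
  rw [← Finset.prod_erase_mul Finset.univ (fun i => (c i).den) (Finset.mem_univ j)]
  push_cast
  rw [mul_assoc, mul_comm ((c j).den : ℚ) (c j), Rat.mul_den_eq_num]


end

end Summit.Schanuel.Schanuel.Theorems.RootDecomp1BTameFlagCore
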